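import Literature.AnabelianGeometry.EtaleTheta.Discharge.Sec1ThetaLiftOfThetaKummerInput
import HarnessLib

/-!
# [EtTh] Prop. 1.5 (iii) «arises from a unique class»: the RANGE of the inflation
# `H¹((Π^tp_Ÿ)^Θ, Δ_Θ) → H¹(Π^tp_Ÿ, Δ_Θ)` is exactly the classes dying on `Ker(Π^tp_X ↠ (Π^tp_X)^Θ)` (proof-only)

S. Mochizuki, *The étale theta function and its Frobenioid-theoretic manifestations*, Publ. RIMS **45**
(2009) [EtTh], §1, Prop. 1.5 (iii), PRIMS PDF p. 23 (printed 249): "Any class `η̈^Θ ∈ H¹(Π^tp_Ÿ, Δ_Θ)` arises from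
a unique class `η̈^Θ ∈ H¹((Π^tp_Ÿ)^Θ, Δ_Θ)` …" [cite: MochizukiEtTh2009, Prop 1.5 (iii) p.23]; the generic fact is
the degree-one inflation–restriction sequence [cite: NeukirchSchmidtWingberg2008, I §6]. Layer L2 of the
abc-iut cell, seat abc-iut-L2-t12 (gen 7); sequel of `Discharge/Sec1ThetaLiftOfThetaKummerInput.lean` (p459709),
whose cocycle-level descent `ContH1.exists_infl_mk_eq_mk` is upgraded here to CLASS-LEVEL statements.
PROOF-ONLY (no `def`, no instance, no `Prop` fact).

* `ContH1.res_ker_infl_eq_one` — restriction of an inflated class to `Ker ψ` is trivial;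
* `ContH1.mem_range_infl_iff_res_ker_eq_one` — along a continuous OPEN homomorphism `ψ` with `Ker ψ ≤ H₀`,
  a class of `H₀` is inflated from `ψ(H₀)` IFF its restriction to `Ker ψ` is trivial (exactness of
  `H¹(ψ(H₀), A) → H¹(H₀, A) → H¹(Ker ψ, A)` in the tree's concrete `ContH1`);
* `ContH1.existsUnique_infl_eq_iff` — with abc-iut-L2-t1's `infl_injective_of_surjective`: `∃!` form;
* `ThetaSetting.mem_range_inflTheta_iff` / `existsUnique_inflTheta_eq_iff` — at any theta setting with
  `HasThetaTopology`: a class `x ∈ H¹(Π^tp_Ÿ, Δ_Θ)` «arises from a (unique) class of `H¹((Π^tp_Ÿ)^Θ, Δ_Θ)`» IFF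
  `res_{Ker(Π^tp_X ↠ (Π^tp_X)^Θ)} x = 1` — the exact content of the first clause of Prop. 1.5 (iii) for an ARBITRARY
  class (for the Kummer class of `Θ̈` the criterion is the function-level clause (hroots) of p459709).

HONEST FRAMING: generic homological algebra / topology over the frozen root; nothing of [EtTh] is asserted; typed ≠
proved; no side is taken on [IUTchIII] Cor. 3.12.
-/

noncomputable section

namespace Literature.AnabelianGeometry.EtaleTheta

open Literature.AnabelianGeometry.SemiGraphs _root_.Topology
open scoped IsMulCommutative

/-! ### 1. Generic: the range of inflation in degree one -/

namespace ContH1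

variable {G₀ G' : Type*} [Group G₀] [TopologicalSpace G₀]
  [Group G'] [TopologicalSpace G'] [IsTopologicalGroup G'] {ψ : G₀ →* G'} (hψ : Continuous ψ)
  {A : Subgroup G'} [A.Normal] [IsMulCommutative A] {H₀ : Subgroup G₀}

/-- A continuous cocycle vanishes at the identity. [cite: NeukirchSchmidtWingberg2008, I §2] -/
theorem apply_one_of_mem_contCocycles {f : H₀ → A} (hf : f ∈ contCocycles ψ A H₀) : f 1 = 1 := by
  have h := hf.2 1 1
  rw [mul_one, OneMemClass.coe_one, map_one, map_one, MulAut.one_apply] at h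
  exact left_eq_mul.mp h

/-- **Inflated classes die on the kernel**: `res_{Ker ψ} (infl x′) = 1`. [cite: NeukirchSchmidtWingberg2008, I §6] -/
theorem res_ker_infl_eq_one (hker : ψ.ker ≤ H₀) (x' : ContH1 (MonoidHom.id G') A (H₀.map ψ)) :
    ContH1.res ψ A hker (ContH1.infl A ψ hψ le_rfl x') = 1 := by
  induction x' using QuotientGroup.induction_on with
  | H g =>
    change ContH1.mk (fun k : ψ.ker => g.1 ⟨ψ ((⟨k.1, hker k.2⟩ : H₀) : G₀), ⟨k.1, hker k.2, rfl⟩⟩) _ = 1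
    rw [← ContH1.mk_one]
    refine ContH1.mk_congr _ (funext fun k => ?_) _ _
    have hk : (⟨ψ ((⟨k.1, hker k.2⟩ : H₀) : G₀), ⟨k.1, hker k.2, rfl⟩⟩ : H₀.map ψ) = 1 :=
      Subtype.ext (MonoidHom.mem_ker.mp k.2)
    rw [hk, Pi.one_apply]
    exact apply_one_of_mem_contCocycles g.2

/-- On `Ker ψ` (trivial action through `ψ`) a class vanishes iff its cocycle vanishes identically.
[cite: NeukirchSchmidtWingberg2008, I §2] -/
theorem mk_ker_eq_one_iff {f : ψ.ker → A} (hf : f ∈ contCocycles ψ A ψ.ker) :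
    ContH1.mk f hf = 1 ↔ ∀ k, f k = 1 := by
  rw [ContH1.mk_eq_one_iff, mem_contCoboundaries_iff]
  constructor
  · rintro ⟨a, ha⟩ k
    rw [ha]
    show MulAut.conjNormal (ψ (k : G₀)) a * a⁻¹ = 1
    rw [MonoidHom.mem_ker.mp k.2, map_one, MulAut.one_apply, mul_inv_cancel]
  · intro h
    refine ⟨1, funext fun k => ?_⟩
    rw [h k, map_one, inv_one, mul_one]

/-- **Exactness at `H¹(H₀, A)`**: along a continuous OPEN homomorphism `ψ` with `Ker ψ ≤ H₀`, a class of `H₀` is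
inflated from `ψ(H₀)` iff its restriction to `Ker ψ` is trivial (cocycle-level descent
`ContH1.exists_infl_mk_eq_mk`, p459709). [cite: NeukirchSchmidtWingberg2008, I §6] -/
theorem mem_range_infl_iff_res_ker_eq_one (hopen : IsOpenMap ψ) (hker : ψ.ker ≤ H₀) (x : ContH1 ψ A H₀) :
    x ∈ (ContH1.infl A ψ hψ (le_rfl : H₀.map ψ ≤ H₀.map ψ)).range ↔ ContH1.res ψ A hker x = 1 := by
  constructor
  · rintro ⟨x', rfl⟩
    exact res_ker_infl_eq_one hψ hker x'
  · intro hx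
    induction x using QuotientGroup.induction_on with
    | H f =>
      have hx' : ContH1.mk (fun k : ψ.ker => f.1 ⟨k.1, hker k.2⟩) (ContH1.resCocycle ψ A hker f).2 = 1 := hx
      rw [mk_ker_eq_one_iff] at hx'
      obtain ⟨g, hg, -, hinfl⟩ := ContH1.exists_infl_mk_eq_mk hψ hopen hker f.1 f.2 fun h hh =>
        hx' ⟨h.1, MonoidHom.mem_ker.mpr hh⟩
      exact ⟨ContH1.mk g hg, hinfl⟩

/-- **«Arises from a unique class», generic form**: `∃! x′, infl x′ = x` iff `res_{Ker ψ} x = 1` (existence: the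
range criterion; uniqueness: abc-iut-L2-t1's `infl_injective_of_surjective`). [cite: NeukirchSchmidtWingberg2008, I §6] -/
theorem existsUnique_infl_eq_iff (hopen : IsOpenMap ψ) (hker : ψ.ker ≤ H₀) (x : ContH1 ψ A H₀) :
    (∃! x' : ContH1 (MonoidHom.id G') A (H₀.map ψ), ContH1.infl A ψ hψ le_rfl x' = x) ↔
      ContH1.res ψ A hker x = 1 := by
  rw [← mem_range_infl_iff_res_ker_eq_one hψ hopen hker x]
  constructor
  · rintro ⟨x', hx', -⟩
    exact ⟨x', hx'⟩
  · rintro ⟨x', hx'⟩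
    refine ⟨x', hx', fun y hy => ?_⟩
    exact ContH1.infl_injective_of_surjective (hψ := hψ) le_rfl
      (fun y' => by obtain ⟨h, hh, hy'⟩ := y'.2; exact ⟨⟨h, hh⟩, hy'⟩) (hy.trans hx'.symm)

end ContH1

/-! ### 2. At a theta setting: the first clause of Prop. 1.5 (iii) for an arbitrary class -/

namespace ThetaSetting

variable {p : ℕ} [Fact p.Prime] {D : ThetaSetting p}

/-- **A class `x ∈ H¹(Π^tp_Ÿ, Δ_Θ)` arises from `H¹((Π^tp_Ÿ)^Θ, Δ_Θ)` iff it dies on `Ker(Π^tp_X ↠ (Π^tp_X)^Θ)`**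
(under `HasThetaTopology`; abc-iut-L2-t1's `ker_toTheta_le_GtpYdd`). [cite: MochizukiEtTh2009, Prop 1.5 (iii) p.23] -/
theorem mem_range_inflTheta_iff (hT : D.HasThetaTopology) (x : D.H1 D.GtpYdd) :
    x ∈ (D.inflTheta D.GtpYdd).range ↔ ContH1.res D.toTheta D.DeltaTheta D.ker_toTheta_le_GtpYdd x = 1 :=
  ContH1.mem_range_infl_iff_res_ker_eq_one D.continuous_toTheta
    (isOpenMap_of_isQuotientMap hT.isQuotientMap_toTheta) D.ker_toTheta_le_GtpYdd x

/-- **«Any class … arises from a unique class», for an ARBITRARY class**: `∃! x′ ∈ H¹((Π^tp_Ÿ)^Θ, Δ_Θ)` with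
`infl x′ = x` iff `res_{Ker(Π^tp_X ↠ (Π^tp_X)^Θ)} x = 1`. [cite: MochizukiEtTh2009, Prop 1.5 (iii) p.23] -/
theorem existsUnique_inflTheta_eq_iff (hT : D.HasThetaTopology) (x : D.H1 D.GtpYdd) :
    (∃! x' : D.H1Theta (D.GtpYdd.map D.toTheta), D.inflTheta D.GtpYdd x' = x) ↔
      ContH1.res D.toTheta D.DeltaTheta D.ker_toTheta_le_GtpYdd x = 1 :=
  ContH1.existsUnique_infl_eq_iff D.continuous_toTheta (isOpenMap_of_isQuotientMap hT.isQuotientMap_toTheta)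
    D.ker_toTheta_le_GtpYdd x

/-- In particular every inflated class — e.g. every theta class admitting the `Θ`-lift of Prop. 1.5 (iii) — dies on
`Ker(Π^tp_X ↠ (Π^tp_X)^Θ)` (no topological hypothesis). [cite: MochizukiEtTh2009, Prop 1.5 (iii) p.23] -/
theorem res_ker_toTheta_inflTheta_eq_one (x' : D.H1Theta (D.GtpYdd.map D.toTheta)) :
    ContH1.res D.toTheta D.DeltaTheta D.ker_toTheta_le_GtpYdd (D.inflTheta D.GtpYdd x') = 1 :=
  ContH1.res_ker_infl_eq_one D.continuous_toTheta D.ker_toTheta_le_GtpYdd x'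

end ThetaSetting

end Literature.AnabelianGeometry.EtaleTheta

end
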